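import Summits.ABC.IUTFork.Cor312SoundInputTwist
import Summits.ABC.IUTFork.Cor312SoundInputReindex
import Summits.ABC.IUTFork.Cor312SoundInputPilot
import HarnessLib

/-!
# [IUTchIII] Cor. 3.12 — BOTH levels of the gap row are separately canonical (per-level C-transports)

Record-only file (D-0012) of the abc-iut cell (D-0067 Cor. 3.12 strategy TEAM C «étale-picture /
multiradiality», seat abc-iut-c312-13, row C-10 of `HOME/plan/C312-TEAMS.md`); TAKES NO SIDE.
GAP-LEDGER row G-c312-9-1 carries its gap statement at TWO LEVELS (SUPPLEMENT, c312-10, 01:10Z):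
LEVEL 0 = the pilot-strip reading `SoundAtPilot` (≡ the printed Statement,
`soundAtPilot_iff_statement`), LEVEL 1 = `SoundAtInput` = LEVEL 0 ∧ `SoundOffPilot`
(`soundAtInput_iff_statement_and_offPilot`, A1/skel XXVc). Rows C-8/C-9 proved the CONJUNCTION
canonical under every re-choice the frozen types leave open; this file shows EACH CONJUNCT is
separately canonical — pre-empting «the LEVEL-1 invariance might be carried by the LEVEL-0 conjunct
alone while the off-pilot content moves»: it is not; the off-pilot conjunct transports by the same
iffs (§1 Θ-glue (Ind1)(Ind2) twist, NO hypothesis; §2 column transport; §3 (Ind3) m-reindex, NO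
hypothesis; §4 q-glue twist). HONEST ASYMMETRY made kernel-visible in §4: the PILOT conjunct is
q-twist-invariant from the Step (x) volume invariance at the q-PILOT image alone
(`qRegion_adm` is a THEOREM — no admissibility hypothesis at all,
`qTwistGlue_soundAtPilot_iff_of_invariance`), while the OFF-PILOT conjunct still needs the per-object
q-glue admissibility `hadm` (the frozen `Setting` constrains only the q-pilot image — row C-8 §4's
quantifier cost sits ENTIRELY on the off-pilot side, exactly where w5-d211/w5-d236 located the free
binders). Consumes rows C-8 (`Cor312SoundInputTwist`), C-9 (`Cor312SoundInputReindex`), A-4's named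
forms (`Cor312SoundInputPilot`) read-only. Deliberately NOT here: any claim that either level holds
or fails for an instantiated setting; any set-level (xi-f) content. Nothing here asserts Cor. 3.12.
[claim: Mochizuki2012, status: disputed] for the quoted clauses; proofs are [folklore] bookkeeping.
-/

noncomputable section

namespace Summit.ABC

namespace IUTFork

namespace Cor312Vol

open Thm311 Cor312 Literature.IUT.LogThetaLattice

variable {T : ThetaIndex} {S : Situation T} (P : Cor312.Setting S)

/-! ## 1. The Θ-side Kummer re-choice: both levels invariant, no hypothesis beyond membership -/

section ThetaTwist
variable (Φ₀ : S.L.PacketAut)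

/-- **LEVEL 0 is twist-canonical**: the pilot-strip reading of Step (xi-f) is invariant under the
Θ-glue (Ind1)(Ind2) re-choice (via its kernel identity with the Statement and row C-1). [folklore] -/
theorem twistGlue_soundAtPilot_iff (G : LinkGluing P) (hΦ₀ : Φ₀ ∈ Setting.indGroup S) :
    SoundAtPilot (P.twistGlue Φ₀) (G.twist P Φ₀) ↔ SoundAtPilot P G :=
  (soundAtPilot_iff_statement (P.twistGlue Φ₀) (G.twist P Φ₀)).trans
    ((P.twistGlue_statement_iff Φ₀ hΦ₀).trans (soundAtPilot_iff_statement P G).symm)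

/-- **LEVEL 1's off-pilot conjunct is twist-canonical**: the content of GapA beyond the printed
Corollary does not move under the Θ-glue re-choice either. NO volume hypothesis. [folklore] -/
theorem twistGlue_soundOffPilot_iff (G : LinkGluing P) (hΦ₀ : Φ₀ ∈ Setting.indGroup S) :
    SoundOffPilot (P.twistGlue Φ₀) (G.twist P Φ₀) ↔ SoundOffPilot P G := by
  unfold SoundOffPilot
  refine forall_congr' fun o => imp_congr Iff.rfl ?_
  rw [twistGlue_negLogThetaAt P Φ₀ hΦ₀ o, LinkGluing.twist_linkMap P Φ₀ G o,
    twistGlue_negLogQAt P Φ₀ (G.linkMap o)]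

end ThetaTwist

/-! ## 2. The column: both levels invariant under the étale-picture transport -/

section Recolumn
variable (n' : ℤ) (Φ : S.L.PacketAut) (hD : S.D n' = (S.D P.n).map Φ)

/-- **LEVEL 0 is column-canonical** (via row C-3's `recolumn_statement_iff`). [folklore] -/
theorem recolumn_soundAtPilot_iff (G : LinkGluing P) (hΦ : Φ ∈ Setting.indGroup S) :
    SoundAtPilot (P.recolumn n' Φ hD) (G.recolumn P n' Φ hD) ↔ SoundAtPilot P G :=
  (soundAtPilot_iff_statement (P.recolumn n' Φ hD) (G.recolumn P n' Φ hD)).trans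
    ((P.recolumn_statement_iff n' Φ hD hΦ).trans (soundAtPilot_iff_statement P G).symm)

/-- **LEVEL 1's off-pilot conjunct is column-canonical**: which vertical line carries the comparison
is immaterial to the off-pilot content as well. [folklore] -/
theorem recolumn_soundOffPilot_iff (G : LinkGluing P) (hΦ : Φ ∈ Setting.indGroup S) :
    SoundOffPilot (P.recolumn n' Φ hD) (G.recolumn P n' Φ hD) ↔ SoundOffPilot P G := by
  unfold SoundOffPilot
  refine forall_congr' fun o => imp_congr Iff.rfl ?_
  rw [recolumn_negLogThetaAt P n' Φ hD hΦ o, LinkGluing.recolumn_linkMap P n' Φ hD G o,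
    recolumn_negLogQAt P n' Φ hD (G.linkMap o)]

end Recolumn

/-! ## 3. The (Ind3) re-index: both levels invariant, no hypothesis -/

section Reindex
variable (e : ℤ ≃ ℤ)

/-- **LEVEL 0 absorbs the (Ind3) re-index** (via row C-1's `reindexGlue_statement_iff`). [folklore] -/
theorem reindexGlue_soundAtPilot_iff (G : LinkGluing P) :
    SoundAtPilot (P.reindexGlue e) (G.reindex P e) ↔ SoundAtPilot P G :=
  (soundAtPilot_iff_statement (P.reindexGlue e) (G.reindex P e)).trans
    ((P.reindexGlue_statement_iff e).trans (soundAtPilot_iff_statement P G).symm)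

/-- **LEVEL 1's off-pilot conjunct absorbs the (Ind3) re-index**: re-indexing the Kummer tower moves
nothing at any input, pilot or not. NO hypothesis. [folklore] -/
theorem reindexGlue_soundOffPilot_iff (G : LinkGluing P) :
    SoundOffPilot (P.reindexGlue e) (G.reindex P e) ↔ SoundOffPilot P G := by
  unfold SoundOffPilot
  refine forall_congr' fun o => imp_congr Iff.rfl ?_
  rw [reindexGlue_negLogThetaAt P e o, LinkGluing.reindex_linkMap P e G o,
    reindexGlue_negLogQAt P e (G.linkMap o)]

end Reindex

/-! ## 4. The q-side re-choice: the quantifier cost sits ENTIRELY on the off-pilot conjunct -/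

section QTwist
variable (Φ₀ : S.L.PacketAut)
  (hmem : ∀ (j : T.Label) (vQ : T.VQ),
    Φ₀ j vQ '' P.qRegionOf (qPilotObject P.qData) j vQ ∈ (P.frame j vQ).Hul)
  (hfin : ∀ j : T.Label, (Function.support fun vQ =>
    (S.D P.n).logvol j vQ (Φ₀ j vQ '' P.qRegionOf (qPilotObject P.qData) j vQ)).Finite)

/-- **LEVEL 0 is q-twist-canonical from the PILOT-level volume equality alone** (row C-7's
`qTwistGlue_statement_iff_of_logvol`: `hvol` quantifies over the q-PILOT image only — no per-object
hypothesis enters the pilot conjunct). [folklore] -/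
theorem qTwistGlue_soundAtPilot_iff_of_logvol (G : LinkGluing P)
    (hvol : ∀ (j : T.Label) (vQ : T.VQ),
      (S.D P.n).logvol j vQ (Φ₀ j vQ '' P.qRegion j vQ) = (S.D P.n).logvol j vQ (P.qRegion j vQ)) :
    SoundAtPilot (P.qTwistGlue Φ₀ hmem hfin) (G.qTwist P Φ₀ hmem hfin) ↔ SoundAtPilot P G :=
  (soundAtPilot_iff_statement (P.qTwistGlue Φ₀ hmem hfin) (G.qTwist P Φ₀ hmem hfin)).trans
    ((P.qTwistGlue_statement_iff_of_logvol Φ₀ hmem hfin hvol).trans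
      (soundAtPilot_iff_statement P G).symm)

/-- **LEVEL 0 needs NO admissibility hypothesis**: granted Step (x)'s generator volume invariance,
the pilot conjunct is q-twist-invariant outright — `qRegion_adm` is a theorem of the frozen fields
(the q-pilot image is a hull-set). Contrast `qTwistGlue_soundOffPilot_iff_of_invariance` below.
[folklore] -/
theorem qTwistGlue_soundAtPilot_iff_of_invariance (G : LinkGluing P)
    (hAdm : ∀ Φ ∈ S.L.Ind1Family ∪ S.L.Ind2Family, ∀ (j : T.Label) (vQ : T.VQ)
      (A : Set (S.L.Packet j vQ)), (S.D P.n).Adm j vQ A ↔ (S.D P.n).Adm j vQ (Φ j vQ '' A))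
    (hvol : (S.D P.n).LogvolInvariant) (hΦ₀ : Φ₀ ∈ Setting.indGroup S) :
    SoundAtPilot (P.qTwistGlue Φ₀ hmem hfin) (G.qTwist P Φ₀ hmem hfin) ↔ SoundAtPilot P G :=
  qTwistGlue_soundAtPilot_iff_of_logvol P Φ₀ hmem hfin G
    (P.logvol_image_qRegion_eq_of_invariance Φ₀ hAdm hvol hΦ₀)

/-- **The OFF-PILOT conjunct under the q-twist, pointwise form**: invariance granted the volume
equality at EVERY object of `†𝒞^⊩_△` — the per-object quantifier is unavoidable here (the off-pilot
inputs range over all of them). [folklore] -/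
theorem qTwistGlue_soundOffPilot_iff_of_logvol (G : LinkGluing P)
    (hvol : ∀ (o' : P.ObΔ) (j : T.Label) (vQ : T.VQ),
      (S.D P.n).logvol j vQ (Φ₀ j vQ '' P.qRegionOf o' j vQ) =
        (S.D P.n).logvol j vQ (P.qRegionOf o' j vQ)) :
    SoundOffPilot (P.qTwistGlue Φ₀ hmem hfin) (G.qTwist P Φ₀ hmem hfin) ↔ SoundOffPilot P G := by
  unfold SoundOffPilot
  refine forall_congr' fun o => imp_congr Iff.rfl ?_
  rw [qTwistGlue_negLogThetaAt P Φ₀ hmem hfin o, LinkGluing.qTwist_linkMap P Φ₀ hmem hfin G o,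
    qTwistGlue_negLogQAt_of_logvol P Φ₀ hmem hfin hvol (G.linkMap o)]

/-- **The OFF-PILOT conjunct carries the WHOLE quantifier cost of row C-8 §4**: its q-twist invariance
needs the per-object q-glue admissibility `hadm` (the frozen `Setting` constrains only the q-pilot
image, `qRegion_mem`) on top of Step (x)'s generator volume invariance — while LEVEL 0 needs neither
(`qTwistGlue_soundAtPilot_iff_of_invariance`). This is the per-level split of the honest cost noted in
row C-8, located exactly on the free off-pilot binders of w5-d211/w5-d236. [folklore] -/
theorem qTwistGlue_soundOffPilot_iff_of_invariance (G : LinkGluing P)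
    (hAdm : ∀ Φ ∈ S.L.Ind1Family ∪ S.L.Ind2Family, ∀ (j : T.Label) (vQ : T.VQ)
      (A : Set (S.L.Packet j vQ)), (S.D P.n).Adm j vQ A ↔ (S.D P.n).Adm j vQ (Φ j vQ '' A))
    (hvol : (S.D P.n).LogvolInvariant) (hΦ₀ : Φ₀ ∈ Setting.indGroup S)
    (hadm : ∀ (o' : P.ObΔ) (j : T.Label) (vQ : T.VQ), (S.D P.n).Adm j vQ (P.qRegionOf o' j vQ)) :
    SoundOffPilot (P.qTwistGlue Φ₀ hmem hfin) (G.qTwist P Φ₀ hmem hfin) ↔ SoundOffPilot P G :=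
  qTwistGlue_soundOffPilot_iff_of_logvol P Φ₀ hmem hfin G
    (logvol_image_qRegionOf_eq_of_invariance P Φ₀ hAdm hvol hΦ₀ hadm)

end QTwist

end Cor312Vol

end IUTFork

end Summit.ABC

end
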